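import Literature.Analysis.FluidPDE.PassiveVectorClass
import Literature.Analysis.FunctionSpaces.TorusFourierModes
import Literature.Analysis.FunctionSpaces.TorusVectorParseval
import HarnessLib

/-!
# Weak passive-vector solutions on `T^d`, mode by mode

Analysis/FluidPDE proof-support file (everything proved; no new definitions). For the weak class
`Torus.IsWeakPassiveVectorOn A T ν b w₀ w` of `PassiveVector.lean`
(`∂ₜw + (b·∇)w + A (w·∇)b + ∇π = νΔw`, `∇·w = 0`; Yoshida–Kaneda 2000, eq. (4)–(5)) we test the
weak formulation (`PassiveVectorClass.setIntegral_test_smul`) with the products `η(t) G_z(x)` of a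
time profile and a **transversal single real Fourier mode** `G_z = Re (e_k • z)`, `z ∈ ℂ^d`,
`k · z = 0` (these are smooth and divergence free, `TorusFourierModes` §SingleMode), and read the
result in Fourier variables (`ŵ(t)(k) = 𝓕(complexify ∘ w(t))(k) ∈ ℂ^d`):

* §1 slice pairings: `∫⟪v, (u·∇)G_z⟫ = Re ∑ⱼ 2πi kⱼ ⟪𝓕(uⱼ v)(k), z⟫_ℂ`
  (`integral_inner_convect_realTrigPoly_singleton`; `∂ⱼ G_z = G_{2πikⱼ z}`) and
  `∫⟪v, (u·∇)G_z + νΔG_z⟫ = Re (-4π²ν|k|² ⟪𝓕v(k), z⟫ + ∑ⱼ 2πi kⱼ ⟪𝓕(uⱼ v)(k), z⟫)`;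
* §2 integrability on `(0,T)` of the modes `t ↦ ŵ(t)(k)`, `t ↦ 𝓕(bⱼ w)(t)(k)`, `t ↦ 𝓕(wⱼ b)(t)(k)`
  (the products `bⱼ w`, `wⱼ b` are in `L¹_{t,x}` because `‖b‖‖w‖` is);
* §3 **the modewise integral identity**: for every `k ∈ ℤ^d` and every transversal `z ∈ ℂ^d`,
  for a.e. `t ∈ (0,T)`,
  `⟪ŵ(t)(k), z⟫ = ⟪ŵ₀(k), z⟫ + ∫_{(0,t]} (-4π²ν|k|² ⟪ŵ(τ)(k), z⟫
      + ∑ⱼ 2πi kⱼ ⟪𝓕(bⱼ w)(τ)(k), z⟫ + A ∑ⱼ 2πi kⱼ ⟪𝓕(wⱼ b)(τ)(k), z⟫) dτ`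
  (`IsWeakPassiveVectorOn.ae_inner_mFourierCoeff_eq`; the Leray projection of the mode equation —
  only transversal `z` are admissible because only divergence-free tests are).

This is the vector twin of `PassiveScalarFourier` / `PassiveScalarDiagFourier`, and the input of the
uniqueness theorem for bounded carriers (`PassiveVectorUniqueness`).

## Mathlib / tree search

Tree: `PassiveVectorClass` (class API, `setIntegral_test_smul`), `TorusFourierModes` §SingleMode
(`integral_inner_realTrigPoly_singleton`, `isDivFree_realTrigPoly_singleton`,
`laplacian_realTrigPoly_singleton`), `TorusTrigPoly.partialDeriv_realTrigPoly`,
`TorusVectorParseval.integrable_complexify_comp`, `DuBoisReymondAE`, `PassiveScalarFourier`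
(`re_integral_eq`). No modewise statement for `IsWeakPassiveVectorOn` existed (2026-08-27).

## References

* K. Yoshida, Y. Kaneda, Phys. Rev. E 63 (2000) 016308, §II eq. (4)–(5). [`YoshidaKaneda2000`]
* R. J. DiPerna, P.-L. Lions, Invent. Math. 98 (1989), §II.1, (12)–(14). [`DiPernaLions1989`]
* R. Temam, *Navier–Stokes Equations* (3rd ed., 1984), Ch. III §1.1. [`Temam1984`]
* L. Grafakos, *Classical Fourier Analysis*, 3rd ed., GTM 249 (2014), §3.1.1. [`Grafakos2014`]
-/

noncomputable section

open MeasureTheory TopologicalSpace Set Function Filter Topology UnitAddTorus Complex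
open scoped ENNReal NNReal InnerProductSpace ComplexConjugate ContDiff

namespace Literature.Analysis.FluidPDE

namespace Torus

variable {d : Type*} [Fintype d] [DecidableEq d]

/-! ## §1 Slice pairings with a single real mode -/

section SliceIdentities

/-- Pointwise expansion of the transport pairing against a single real mode:
`⟪v, (u·∇) Re (e_k • c)⟫ (x) = ∑ⱼ ⟪uⱼ(x) v(x), Re (e_k(x) • 2πi kⱼ c)⟫` (`∂ⱼ Re (e_k • c) = Re (e_k • 2πikⱼ c)`).
[cite: Grafakos2014, §3.1.1] -/
theorem inner_convect_realTrigPoly_singleton_eq_sum (u v : UnitAddTorus d → EuclideanSpace ℝ d)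
    (k : d → ℤ) (c : (d → ℤ) → EuclideanSpace ℂ d) (x : UnitAddTorus d) :
    ⟪v x, FunctionSpaces.Torus.convect u (FunctionSpaces.Torus.realTrigPoly {k} c) x⟫_ℝ =
      ∑ j, ⟪u x j • v x,
        FunctionSpaces.Torus.realTrigPoly {k} (fun k' => (2 * Real.pi * I * (k' j)) • c k') x⟫_ℝ := by
  have h1 : FunctionSpaces.Torus.IsContDiff 1 (FunctionSpaces.Torus.realTrigPoly {k} c) :=
    (FunctionSpaces.Torus.isSmooth_realTrigPoly {k} c).isContDiff (by simp)
  rw [show FunctionSpaces.Torus.convect u (FunctionSpaces.Torus.realTrigPoly {k} c) x =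
      FunctionSpaces.Torus.fderiv (FunctionSpaces.Torus.realTrigPoly {k} c) x (u x) from rfl,
    IsWeakPassiveVectorOn.inner_convect_eq_sum' h1]
  refine Finset.sum_congr rfl fun j _ => ?_
  rw [FunctionSpaces.Torus.partialDeriv_realTrigPoly, real_inner_smul_left]

/-- **The transport pairing of a slice with a single real mode, in Fourier variables**: if all the
products `uⱼ v` are integrable, then
`∫ ⟪v, (u·∇) Re (e_k • c)⟫ = Re ∑ⱼ 2πi kⱼ ⟪𝓕(uⱼ v)(k), c⟫_ℂ`. [cite: Grafakos2014, §3.1.1] -/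
theorem integral_inner_convect_realTrigPoly_singleton {u v : UnitAddTorus d → EuclideanSpace ℝ d}
    (huv : ∀ j, Integrable (fun x => u x j • v x) volume) (k : d → ℤ)
    (c : (d → ℤ) → EuclideanSpace ℂ d) :
    ∫ x, ⟪v x, FunctionSpaces.Torus.convect u (FunctionSpaces.Torus.realTrigPoly {k} c) x⟫_ℝ =
      (∑ j, (2 * Real.pi * I * (k j)) *
        ⟪mFourierCoeff (FunctionSpaces.EuclideanSpace.complexify ∘ fun x => u x j • v x) k, c k⟫_ℂ).re := by
  simp_rw [inner_convect_realTrigPoly_singleton_eq_sum u v k c]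
  rw [integral_finsetSum _ fun j _ => ?_, Complex.re_sum]
  · refine Finset.sum_congr rfl fun j _ => ?_
    rw [FunctionSpaces.Torus.integral_inner_realTrigPoly_singleton (huv j) k, inner_smul_right]
  · exact FunctionSpaces.Torus.integrable_inner_of_continuous (huv j)
      (FunctionSpaces.Torus.continuous_realTrigPoly _ _)

/-- **The viscous pairing of a slice with a single real mode**: for an integrable `v`,
`∫ ⟪v, ν Δ Re (e_k • c)⟫ = Re (-4π²ν|k|² ⟪𝓕v(k), c⟫_ℂ)`. [cite: Grafakos2014, §3.1.1] -/
theorem integral_inner_smul_laplacian_realTrigPoly_singleton {v : UnitAddTorus d → EuclideanSpace ℝ d}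
    (hv : Integrable v volume) (ν : ℝ) (k : d → ℤ) (c : (d → ℤ) → EuclideanSpace ℂ d) :
    ∫ x, ⟪v x, ν • FunctionSpaces.Torus.laplacian (FunctionSpaces.Torus.realTrigPoly {k} c) x⟫_ℝ =
      ((-(((4 * Real.pi ^ 2 * ν * FunctionSpaces.Torus.freqNormSq k : ℝ)) : ℂ)) *
        ⟪mFourierCoeff (FunctionSpaces.EuclideanSpace.complexify ∘ v) k, c k⟫_ℂ).re := by
  simp_rw [FunctionSpaces.Torus.laplacian_realTrigPoly_singleton k c, smul_smul, real_inner_smul_right]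
  rw [integral_const_mul, FunctionSpaces.Torus.integral_inner_realTrigPoly_singleton hv k c,
    ← Complex.re_ofReal_mul]
  congr 1
  push_cast
  ring

/-- **Transport plus viscous pairing of a slice with a single real mode**:
`∫ ⟪v, (u·∇)G + νΔG⟫ = Re (-4π²ν|k|² ⟪𝓕v(k), c⟫ + ∑ⱼ 2πi kⱼ ⟪𝓕(uⱼ v)(k), c⟫)`, `G = Re (e_k • c)`.
[cite: Grafakos2014, §3.1.1] -/
theorem integral_inner_convect_add_smul_laplacian_realTrigPoly_singleton
    {u v : UnitAddTorus d → EuclideanSpace ℝ d} (hv : Integrable v volume)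
    (huv : ∀ j, Integrable (fun x => u x j • v x) volume) (ν : ℝ) (k : d → ℤ)
    (c : (d → ℤ) → EuclideanSpace ℂ d) :
    ∫ x, ⟪v x, FunctionSpaces.Torus.convect u (FunctionSpaces.Torus.realTrigPoly {k} c) x +
        ν • FunctionSpaces.Torus.laplacian (FunctionSpaces.Torus.realTrigPoly {k} c) x⟫_ℝ =
      ((-(((4 * Real.pi ^ 2 * ν * FunctionSpaces.Torus.freqNormSq k : ℝ)) : ℂ)) *
          ⟪mFourierCoeff (FunctionSpaces.EuclideanSpace.complexify ∘ v) k, c k⟫_ℂ +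
        ∑ j, (2 * Real.pi * I * (k j)) *
          ⟪mFourierCoeff (FunctionSpaces.EuclideanSpace.complexify ∘ fun x => u x j • v x) k, c k⟫_ℂ).re := by
  have hG := FunctionSpaces.Torus.isSmooth_realTrigPoly {k} c
  have hi₁ : Integrable (fun x => ⟪v x, FunctionSpaces.Torus.convect u (FunctionSpaces.Torus.realTrigPoly {k} c) x⟫_ℝ)
      volume := by
    simp_rw [inner_convect_realTrigPoly_singleton_eq_sum u v k c]
    exact integrable_finsetSum _ fun j _ => FunctionSpaces.Torus.integrable_inner_of_continuous (huv j)
      (FunctionSpaces.Torus.continuous_realTrigPoly _ _)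
  have hi₂ : Integrable (fun x => ⟪v x, ν • FunctionSpaces.Torus.laplacian (FunctionSpaces.Torus.realTrigPoly {k} c) x⟫_ℝ)
      volume :=
    FunctionSpaces.Torus.integrable_inner_of_continuous hv (hG.laplacian.continuous.const_smul ν)
  simp_rw [inner_add_right]
  rw [integral_add hi₁ hi₂, integral_inner_convect_realTrigPoly_singleton huv k c,
    integral_inner_smul_laplacian_realTrigPoly_singleton hv ν k c, ← Complex.add_re, add_comm]

end SliceIdentities

/-! ## §2 Integrability of the Fourier modes of a weak solution -/

section ModeIntegrability

namespace IsWeakPassiveVectorOn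

variable {A T ν : ℝ} {b w : ℝ → UnitAddTorus d → EuclideanSpace ℝ d} {w₀ : UnitAddTorus d → EuclideanSpace ℝ d}

/-- `complexify ∘ w ∈ L¹((0,T) × T^d; ℂ^d)`. [cite: DiPernaLions1989, §II.1 (12)–(14)] -/
theorem integrable_complexify_uncurry (h : IsWeakPassiveVectorOn A T ν b w₀ w) :
    Integrable (fun p : ℝ × UnitAddTorus d => FunctionSpaces.EuclideanSpace.complexify (w p.1 p.2))
      (((volume : Measure ℝ).restrict (Ioo 0 T)).prod volume) :=
  (FunctionSpaces.EuclideanSpace.complexify (ι := d)).toContinuousLinearMap.integrable_comp h.integrable_uncurry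

/-- Integrability on `(0,T) × T^d` of `e_{-k}(x) • complexify (w(t,x))`. [cite: DiPernaLions1989, §II.1 (12)–(14)] -/
theorem integrable_mFourier_smul (h : IsWeakPassiveVectorOn A T ν b w₀ w) (k : d → ℤ) :
    Integrable (fun p : ℝ × UnitAddTorus d =>
      mFourier (-k) p.2 • FunctionSpaces.EuclideanSpace.complexify (w p.1 p.2))
      (((volume : Measure ℝ).restrict (Ioo 0 T)).prod volume) :=
  h.integrable_complexify_uncurry.bdd_smul 1
    ((mFourier (-k)).continuous.comp continuous_snd).aestronglyMeasurable
    (Eventually.of_forall fun p => ((mFourier (-k)).norm_coe_le_norm p.2).trans_eq mFourier_norm)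

/-- The Fourier modes `t ↦ ŵ(t)(k) = 𝓕(complexify ∘ w(t))(k)` of a weak solution are integrable on
`(0,T)`. [cite: DiPernaLions1989, §II.1 (12)–(14)] -/
theorem integrableOn_mFourierCoeff (h : IsWeakPassiveVectorOn A T ν b w₀ w) (k : d → ℤ) :
    Integrable (fun t => mFourierCoeff (FunctionSpaces.EuclideanSpace.complexify ∘ w t) k)
      (volume.restrict (Ioo 0 T)) := by
  have e : (fun t => mFourierCoeff (FunctionSpaces.EuclideanSpace.complexify ∘ w t) k) =
      fun t => ∫ x, mFourier (-k) x • FunctionSpaces.EuclideanSpace.complexify (w t x) := by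
    funext t
    rw [FunctionSpaces.Torus.mFourierCoeff_eq_integral_volume]
    rfl
  rw [e]
  exact (h.integrable_mFourier_smul k).integral_prod_left

/-- Joint measurability of the products `bⱼ w`. [cite: DiPernaLions1989, §II.1 (12)–(14)] -/
theorem aestronglyMeasurable_carrier_smul (h : IsWeakPassiveVectorOn A T ν b w₀ w) (j : d) :
    AEStronglyMeasurable (fun p : ℝ × UnitAddTorus d => b p.1 p.2 j • w p.1 p.2)
      (((volume : Measure ℝ).restrict (Ioo 0 T)).prod volume) :=
  ((EuclideanSpace.proj j).continuous.comp_aestronglyMeasurable h.aestronglyMeasurable_uncurry_carrier).smul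
    h.aestronglyMeasurable_uncurry

/-- Joint measurability of the products `wⱼ b`. [cite: DiPernaLions1989, §II.1 (12)–(14)] -/
theorem aestronglyMeasurable_smul_carrier (h : IsWeakPassiveVectorOn A T ν b w₀ w) (j : d) :
    AEStronglyMeasurable (fun p : ℝ × UnitAddTorus d => w p.1 p.2 j • b p.1 p.2)
      (((volume : Measure ℝ).restrict (Ioo 0 T)).prod volume) :=
  ((EuclideanSpace.proj j).continuous.comp_aestronglyMeasurable h.aestronglyMeasurable_uncurry).smul
    h.aestronglyMeasurable_uncurry_carrier

/-- `bⱼ w ∈ L¹((0,T) × T^d)` (`|bⱼ| ‖w‖ ≤ ‖b‖ ‖w‖ ∈ L¹`). [cite: DiPernaLions1989, §II.1 (12)–(14)] -/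
theorem integrable_carrier_smul (h : IsWeakPassiveVectorOn A T ν b w₀ w) (j : d) :
    Integrable (fun p : ℝ × UnitAddTorus d => b p.1 p.2 j • w p.1 p.2)
      (((volume : Measure ℝ).restrict (Ioo 0 T)).prod volume) := by
  refine Integrable.mono' h.integrable_norm_carrier_mul_norm (h.aestronglyMeasurable_carrier_smul j)
    (Eventually.of_forall fun p => ?_)
  rw [norm_smul]
  exact mul_le_mul_of_nonneg_right
    (by simpa [Real.norm_eq_abs] using FunctionSpaces.Torus.abs_apply_le_norm (b p.1 p.2) j) (norm_nonneg _)

/-- `wⱼ b ∈ L¹((0,T) × T^d)` (`|wⱼ| ‖b‖ ≤ ‖b‖ ‖w‖ ∈ L¹`). [cite: DiPernaLions1989, §II.1 (12)–(14)] -/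
theorem integrable_smul_carrier (h : IsWeakPassiveVectorOn A T ν b w₀ w) (j : d) :
    Integrable (fun p : ℝ × UnitAddTorus d => w p.1 p.2 j • b p.1 p.2)
      (((volume : Measure ℝ).restrict (Ioo 0 T)).prod volume) := by
  refine Integrable.mono' h.integrable_norm_carrier_mul_norm (h.aestronglyMeasurable_smul_carrier j)
    (Eventually.of_forall fun p => ?_)
  rw [norm_smul, mul_comm]
  exact mul_le_mul_of_nonneg_left
    (by simpa [Real.norm_eq_abs] using FunctionSpaces.Torus.abs_apply_le_norm (w p.1 p.2) j) (norm_nonneg _)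

/-- Integrability on `(0,T) × T^d` of `e_{-k} • complexify (bⱼ w)`. [cite: DiPernaLions1989, §II.1 (12)–(14)] -/
theorem integrable_mFourier_smul_carrier_smul (h : IsWeakPassiveVectorOn A T ν b w₀ w) (j : d) (k : d → ℤ) :
    Integrable (fun p : ℝ × UnitAddTorus d =>
      mFourier (-k) p.2 • FunctionSpaces.EuclideanSpace.complexify (b p.1 p.2 j • w p.1 p.2))
      (((volume : Measure ℝ).restrict (Ioo 0 T)).prod volume) :=
  ((FunctionSpaces.EuclideanSpace.complexify (ι := d)).toContinuousLinearMap.integrable_comp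
    (h.integrable_carrier_smul j)).bdd_smul 1
    ((mFourier (-k)).continuous.comp continuous_snd).aestronglyMeasurable
    (Eventually.of_forall fun p => ((mFourier (-k)).norm_coe_le_norm p.2).trans_eq mFourier_norm)

/-- Integrability on `(0,T) × T^d` of `e_{-k} • complexify (wⱼ b)`. [cite: DiPernaLions1989, §II.1 (12)–(14)] -/
theorem integrable_mFourier_smul_smul_carrier (h : IsWeakPassiveVectorOn A T ν b w₀ w) (j : d) (k : d → ℤ) :
    Integrable (fun p : ℝ × UnitAddTorus d =>
      mFourier (-k) p.2 • FunctionSpaces.EuclideanSpace.complexify (w p.1 p.2 j • b p.1 p.2))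
      (((volume : Measure ℝ).restrict (Ioo 0 T)).prod volume) :=
  ((FunctionSpaces.EuclideanSpace.complexify (ι := d)).toContinuousLinearMap.integrable_comp
    (h.integrable_smul_carrier j)).bdd_smul 1
    ((mFourier (-k)).continuous.comp continuous_snd).aestronglyMeasurable
    (Eventually.of_forall fun p => ((mFourier (-k)).norm_coe_le_norm p.2).trans_eq mFourier_norm)

/-- The modes `t ↦ 𝓕(bⱼ w)(t)(k)` are integrable on `(0,T)`. [cite: DiPernaLions1989, §II.1 (12)–(14)] -/
theorem integrableOn_mFourierCoeff_carrier_smul (h : IsWeakPassiveVectorOn A T ν b w₀ w) (j : d) (k : d → ℤ) :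
    Integrable (fun t => mFourierCoeff
        (FunctionSpaces.EuclideanSpace.complexify ∘ fun x => b t x j • w t x) k)
      (volume.restrict (Ioo 0 T)) := by
  have e : (fun t => mFourierCoeff
        (FunctionSpaces.EuclideanSpace.complexify ∘ fun x => b t x j • w t x) k) =
      fun t => ∫ x, mFourier (-k) x • FunctionSpaces.EuclideanSpace.complexify (b t x j • w t x) := by
    funext t
    rw [FunctionSpaces.Torus.mFourierCoeff_eq_integral_volume]
    rfl
  rw [e]
  exact (h.integrable_mFourier_smul_carrier_smul j k).integral_prod_left

/-- The modes `t ↦ 𝓕(wⱼ b)(t)(k)` are integrable on `(0,T)`. [cite: DiPernaLions1989, §II.1 (12)–(14)] -/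
theorem integrableOn_mFourierCoeff_smul_carrier (h : IsWeakPassiveVectorOn A T ν b w₀ w) (j : d) (k : d → ℤ) :
    Integrable (fun t => mFourierCoeff
        (FunctionSpaces.EuclideanSpace.complexify ∘ fun x => w t x j • b t x) k)
      (volume.restrict (Ioo 0 T)) := by
  have e : (fun t => mFourierCoeff
        (FunctionSpaces.EuclideanSpace.complexify ∘ fun x => w t x j • b t x) k) =
      fun t => ∫ x, mFourier (-k) x • FunctionSpaces.EuclideanSpace.complexify (w t x j • b t x) := by
    funext t
    rw [FunctionSpaces.Torus.mFourierCoeff_eq_integral_volume]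
    rfl
  rw [e]
  exact (h.integrable_mFourier_smul_smul_carrier j k).integral_prod_left

/-- For a.e. `t ∈ (0,T)`: the slice `w t` and all the products `bⱼ(t) w(t)`, `wⱼ(t) b(t)` are
integrable on `T^d`. [cite: DiPernaLions1989, §II.1 (12)–(14)] -/
theorem ae_integrable_slice (h : IsWeakPassiveVectorOn A T ν b w₀ w) :
    ∀ᵐ t ∂(volume.restrict (Ioo 0 T)),
      Integrable (w t) volume ∧ (∀ j, Integrable (fun x => b t x j • w t x) volume) ∧
        (∀ j, Integrable (fun x => w t x j • b t x) volume) := by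
  have h1 : ∀ᵐ t ∂(volume.restrict (Ioo 0 T)), ∀ j, Integrable (fun x => b t x j • w t x) volume :=
    ae_all_iff.2 fun j => (h.integrable_carrier_smul j).prod_right_ae
  have h2 : ∀ᵐ t ∂(volume.restrict (Ioo 0 T)), ∀ j, Integrable (fun x => w t x j • b t x) volume :=
    ae_all_iff.2 fun j => (h.integrable_smul_carrier j).prod_right_ae
  filter_upwards [h.ae_memLp_two, h1, h2] with t ht h1t h2t
  exact ⟨ht.integrable one_le_two, h1t, h2t⟩

/-- Integrability on `(0,T)` of the modewise right-hand side
`-4π²ν|k|² ⟪ŵ(τ)(k), z⟫ + (∑ⱼ 2πi kⱼ ⟪𝓕(bⱼ w)(τ)(k), z⟫ + A ∑ⱼ 2πi kⱼ ⟪𝓕(wⱼ b)(τ)(k), z⟫)`.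
[cite: DiPernaLions1989, §II.1 (12)–(14)] -/
theorem integrableOn_modeRHS (h : IsWeakPassiveVectorOn A T ν b w₀ w) (k : d → ℤ) (z : EuclideanSpace ℂ d) :
    Integrable (fun τ =>
      (-(((4 * Real.pi ^ 2 * ν * FunctionSpaces.Torus.freqNormSq k : ℝ)) : ℂ)) *
          ⟪mFourierCoeff (FunctionSpaces.EuclideanSpace.complexify ∘ w τ) k, z⟫_ℂ +
        ((∑ j, (2 * Real.pi * I * (k j)) *
            ⟪mFourierCoeff (FunctionSpaces.EuclideanSpace.complexify ∘ fun x => b τ x j • w τ x) k, z⟫_ℂ) +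
          (A : ℂ) * ∑ j, (2 * Real.pi * I * (k j)) *
            ⟪mFourierCoeff (FunctionSpaces.EuclideanSpace.complexify ∘ fun x => w τ x j • b τ x) k, z⟫_ℂ))
      (volume.restrict (Ioo 0 T)) :=
  (((h.integrableOn_mFourierCoeff k).inner_const z).const_mul _).add
    ((integrable_finsetSum _ fun j _ => ((h.integrableOn_mFourierCoeff_carrier_smul j k).inner_const z).const_mul _).add
      ((integrable_finsetSum _ fun j _ =>
        ((h.integrableOn_mFourierCoeff_smul_carrier j k).inner_const z).const_mul _).const_mul _))

end IsWeakPassiveVectorOn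

end ModeIntegrability

/-! ## §3 The modewise integral identity -/

section ModeIdentity

namespace IsWeakPassiveVectorOn

variable {A T ν : ℝ} {b w : ℝ → UnitAddTorus d → EuclideanSpace ℝ d} {w₀ : UnitAddTorus d → EuclideanSpace ℝ d}

/-- **The modewise integral identity, tested (real) form.** For every `k ∈ ℤ^d` and every
coefficient family `c` transversal at `k` (`k · c k = 0`), for a.e. `t ∈ (0,T)`,
`Re ⟪ŵ(t)(k), c k⟫ = Re ⟪ŵ₀(k), c k⟫ + ∫_{(0,t]} Re (-4π²ν|k|² ⟪ŵ(τ)(k), c k⟫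
  + ∑ⱼ 2πi kⱼ ⟪𝓕(bⱼ w)(τ)(k), c k⟫ + A ∑ⱼ 2πi kⱼ ⟪𝓕(wⱼ b)(τ)(k), c k⟫) dτ`
(the weak formulation tested with `η(t) Re (e_k(x) • c k)` — a smooth divergence-free test,
Temam 1984 Ch. III §1.1 — and the a.e. du Bois-Reymond lemma with datum).
[cite: Temam1984, Ch. III §1.1] -/
theorem ae_re_inner_mFourierCoeff_eq (h : IsWeakPassiveVectorOn A T ν b w₀ w)
    (hw₀ : Integrable w₀ volume) (k : d → ℤ) {c : (d → ℤ) → EuclideanSpace ℂ d}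
    (hz : ∑ j, (k j : ℂ) * c k j = 0) :
    ∀ᵐ t ∂(volume.restrict (Ioo 0 T)),
      (⟪mFourierCoeff (FunctionSpaces.EuclideanSpace.complexify ∘ w t) k, c k⟫_ℂ).re =
        (⟪mFourierCoeff (FunctionSpaces.EuclideanSpace.complexify ∘ w₀) k, c k⟫_ℂ).re +
        ∫ τ in Ioc 0 t,
          ((-(((4 * Real.pi ^ 2 * ν * FunctionSpaces.Torus.freqNormSq k : ℝ)) : ℂ)) *
              ⟪mFourierCoeff (FunctionSpaces.EuclideanSpace.complexify ∘ w τ) k, c k⟫_ℂ +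
            ((∑ j, (2 * Real.pi * I * (k j)) *
                ⟪mFourierCoeff (FunctionSpaces.EuclideanSpace.complexify ∘ fun x => b τ x j • w τ x) k, c k⟫_ℂ) +
              (A : ℂ) * ∑ j, (2 * Real.pi * I * (k j)) *
                ⟪mFourierCoeff (FunctionSpaces.EuclideanSpace.complexify ∘ fun x => w τ x j • b τ x) k, c k⟫_ℂ)).re := by
  have hAi : Integrable (fun t => ⟪mFourierCoeff (FunctionSpaces.EuclideanSpace.complexify ∘ w t) k, c k⟫_ℂ)
      (volume.restrict (Ioo 0 T)) := (h.integrableOn_mFourierCoeff k).inner_const (c k)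
  have hBi := h.integrableOn_modeRHS k (c k)
  refine FunctionSpaces.ae_eq_add_setIntegral_of_forall_test hAi.re hBi.re fun η hη hηc hηT => ?_
  have key := h.setIntegral_test_smul hη hηc hηT (FunctionSpaces.Torus.isSmooth_realTrigPoly {k} c)
    (FunctionSpaces.Torus.isDivFree_realTrigPoly_singleton hz)
  rw [FunctionSpaces.Torus.integral_inner_realTrigPoly_singleton hw₀ k c] at key
  have hae : ∀ᵐ τ ∂(volume.restrict (Ioo 0 T)),
      (deriv η τ * ∫ x, ⟪w τ x, FunctionSpaces.Torus.realTrigPoly {k} c x⟫_ℝ) +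
        η τ * ((∫ x, ⟪w τ x, FunctionSpaces.Torus.convect (b τ) (FunctionSpaces.Torus.realTrigPoly {k} c) x +
            ν • FunctionSpaces.Torus.laplacian (FunctionSpaces.Torus.realTrigPoly {k} c) x⟫_ℝ) +
          A * ∫ x, ⟪b τ x, FunctionSpaces.Torus.convect (w τ) (FunctionSpaces.Torus.realTrigPoly {k} c) x⟫_ℝ) =
      deriv η τ * (⟪mFourierCoeff (FunctionSpaces.EuclideanSpace.complexify ∘ w τ) k, c k⟫_ℂ).re +
        η τ * ((-(((4 * Real.pi ^ 2 * ν * FunctionSpaces.Torus.freqNormSq k : ℝ)) : ℂ)) *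
              ⟪mFourierCoeff (FunctionSpaces.EuclideanSpace.complexify ∘ w τ) k, c k⟫_ℂ +
            ((∑ j, (2 * Real.pi * I * (k j)) *
                ⟪mFourierCoeff (FunctionSpaces.EuclideanSpace.complexify ∘ fun x => b τ x j • w τ x) k, c k⟫_ℂ) +
              (A : ℂ) * ∑ j, (2 * Real.pi * I * (k j)) *
                ⟪mFourierCoeff (FunctionSpaces.EuclideanSpace.complexify ∘ fun x => w τ x j • b τ x) k, c k⟫_ℂ)).re := by
    filter_upwards [h.ae_integrable_slice] with τ hτ
    rw [FunctionSpaces.Torus.integral_inner_realTrigPoly_singleton hτ.1 k c,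
      integral_inner_convect_add_smul_laplacian_realTrigPoly_singleton hτ.1 hτ.2.1 ν k c,
      integral_inner_convect_realTrigPoly_singleton hτ.2.2 k c, ← Complex.re_ofReal_mul A, ← Complex.add_re,
      add_assoc]
  rw [integral_congr_ae hae] at key
  exact key

/-- **The Fourier modes of a weak passive-vector solution solve the (Leray-projected) mode
equations in integrated form.** For a weak solution `w ∈ L^∞(0,T; L²(T^d))` of
`∂ₜw + (b·∇)w + A (w·∇)b + ∇π = νΔw`, `∇·w = 0`, with datum `w₀ ∈ L¹`, every `k ∈ ℤ^d` and every
transversal `z ∈ ℂ^d` (`k · z = 0`): for a.e. `t ∈ (0,T)`,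
`⟪ŵ(t)(k), z⟫ = ⟪ŵ₀(k), z⟫ + ∫_{(0,t]} (-4π²ν|k|² ⟪ŵ(τ)(k), z⟫
  + ∑ⱼ 2πi kⱼ ⟪𝓕(bⱼ w)(τ)(k), z⟫ + A ∑ⱼ 2πi kⱼ ⟪𝓕(wⱼ b)(τ)(k), z⟫) dτ`
(real and imaginary parts from `ae_re_inner_mFourierCoeff_eq` with `z` and `i z`; DiPerna–Lions 1989
(13)–(14) tested against the characters, here against the divergence-free vector characters).
[cite: DiPernaLions1989, §II.1 (13)–(14)] -/
theorem ae_inner_mFourierCoeff_eq (h : IsWeakPassiveVectorOn A T ν b w₀ w)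
    (hw₀ : Integrable w₀ volume) (k : d → ℤ) {z : EuclideanSpace ℂ d}
    (hz : ∑ j, (k j : ℂ) * z j = 0) :
    ∀ᵐ t ∂(volume.restrict (Ioo 0 T)),
      ⟪mFourierCoeff (FunctionSpaces.EuclideanSpace.complexify ∘ w t) k, z⟫_ℂ =
        ⟪mFourierCoeff (FunctionSpaces.EuclideanSpace.complexify ∘ w₀) k, z⟫_ℂ +
        ∫ τ in Ioc 0 t,
          ((-(((4 * Real.pi ^ 2 * ν * FunctionSpaces.Torus.freqNormSq k : ℝ)) : ℂ)) *
              ⟪mFourierCoeff (FunctionSpaces.EuclideanSpace.complexify ∘ w τ) k, z⟫_ℂ +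
            ((∑ j, (2 * Real.pi * I * (k j)) *
                ⟪mFourierCoeff (FunctionSpaces.EuclideanSpace.complexify ∘ fun x => b τ x j • w τ x) k, z⟫_ℂ) +
              (A : ℂ) * ∑ j, (2 * Real.pi * I * (k j)) *
                ⟪mFourierCoeff (FunctionSpaces.EuclideanSpace.complexify ∘ fun x => w τ x j • b τ x) k, z⟫_ℂ)) := by
  have hBi := h.integrableOn_modeRHS k z
  -- the transversal families `z` and `i z`
  have hz' : ∑ j, (k j : ℂ) * (fun _ : d → ℤ => I • z) k j = 0 := by
    simp only [PiLp.smul_apply, smul_eq_mul]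
    calc ∑ j, (k j : ℂ) * (I * z j) = I * ∑ j, (k j : ℂ) * z j := by
          rw [Finset.mul_sum]; exact Finset.sum_congr rfl fun j _ => by ring
      _ = 0 := by rw [hz, mul_zero]
  have h1 := h.ae_re_inner_mFourierCoeff_eq hw₀ k (c := fun _ => z) hz
  have hI := h.ae_re_inner_mFourierCoeff_eq hw₀ k (c := fun _ => I • z) hz'
  filter_upwards [h1, hI, ae_restrict_mem measurableSet_Ioo] with t h1 hI ht
  have hBt := (show IntegrableOn _ (Ioo 0 T) volume from hBi).mono_set (Ioc_subset_Ioo_right ht.2)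
  -- pull the factor `i` out of every pairing
  have pull : ∀ (X : ℂ) (F G : d → ℂ),
      (-(((4 * Real.pi ^ 2 * ν * FunctionSpaces.Torus.freqNormSq k : ℝ)) : ℂ)) * (I * X) +
        ((∑ j, (2 * Real.pi * I * (k j)) * (I * F j)) + (A : ℂ) * ∑ j, (2 * Real.pi * I * (k j)) * (I * G j)) =
      I * ((-(((4 * Real.pi ^ 2 * ν * FunctionSpaces.Torus.freqNormSq k : ℝ)) : ℂ)) * X +
        ((∑ j, (2 * Real.pi * I * (k j)) * F j) + (A : ℂ) * ∑ j, (2 * Real.pi * I * (k j)) * G j)) := by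
    intro X F G
    have e1 : ∑ j, (2 * Real.pi * I * (k j)) * (I * F j) = I * ∑ j, (2 * Real.pi * I * (k j)) * F j := by
      rw [Finset.mul_sum]; exact Finset.sum_congr rfl fun j _ => by ring
    have e2 : ∑ j, (2 * Real.pi * I * (k j)) * (I * G j) = I * ∑ j, (2 * Real.pi * I * (k j)) * G j := by
      rw [Finset.mul_sum]; exact Finset.sum_congr rfl fun j _ => by ring
    rw [e1, e2]
    ring
  simp only [inner_smul_right] at hI
  simp only [pull, I_mul_re] at hI
  rw [integral_neg, ← neg_add, neg_inj] at hI
  apply Complex.ext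
  · rw [h1, Complex.add_re, re_integral_eq hBt]
  · rw [hI, Complex.add_im, im_integral_eq hBt]

end IsWeakPassiveVectorOn

end ModeIdentity

end Torus

end Literature.Analysis.FluidPDE

end
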